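import Summits.CriticalPhenomena.PercolationContinuityZ3.Theorems.PercNearOneGluingNoHeavyPcintNawChainZ4C10Check1
import HarnessLib

/-!
# PCINT lane, kernel reduced-state B2c (chain) certificate `Z4C10` (d = 4, memory τ = 10, kc = 4, 729 state classes): the theorem

Cell `prim-pcint`, seat `prim-pcint-1` (gen 5); memo `run/shared/lean/prim/pcint/INTERVAL-PLAN.md` §16 ("checker for the reduced-state
automata"; chain bookkeeping REDUCTIONS §B2c).  Does NOT build on p205010.  Data for `NawK.le_siteCriticalProb_of_checkRowsC` (`…PcintNawChainMemKernelCert`):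
`p = 16930/100000`, `q̄ = 97709/100000` (`q̄^8·100000^8 ≥ (100000-16930)·100000^7`), `λ = 99999/100000`; Collatz–Wielandt weights (scale 10⁹) from a
power iteration, exact off-line max row ratio 0.9995368571 < λ.  Generated by gen5/gen_lean.py (pcint-1 folder); the kernel re-checks every row.
-/

namespace Summit.CriticalPhenomena.PercolationContinuityZ3.Theorems.Pcint

open Literature.Probability.Percolation Literature.Probability.LatticeModels

/-- **`p_c^site(ℤ⁴) ≥ 0.1693`** (kernel-checked reduced-state B2c (chain-bookkeeping) certificate: memory-`10` dangerous-set
automaton, kc = 4, 729 state classes, `decide +kernel` only). [folklore] -/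
theorem siteCriticalProb_Z4_ge_01693_chain : (0.1693 : ℝ) ≤ siteCriticalProb (zdGraph 4) 0 := by
  have h := NawK.le_siteCriticalProb_of_checkRowsC (d := 4) (τ := 10) (kc := 4) (N := 729) (pn := 16930) (Q := 97709) (D := 100000)
    (lamN := 99999) (lamD := 100000) (syms := NawChainZ4C10.syms) (t := NawChainZ4C10.tree) (by norm_num)
    (fun c => NawK.symOfTab 4 (NawChainZ4C10.syms.getD c [])) (NawK.syms_spec_of_valid NawChainZ4C10.syms_valid)
    (fun i hi => WinK.of_allRange NawChainZ4C10.file_1 (Nat.zero_le i) hi)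
    (by norm_num) (by decide +kernel) (by norm_num) (by norm_num) (by norm_num) (by norm_num) (by norm_num)
  have e : ((16930 : ℕ) : ℝ) / ((100000 : ℕ) : ℝ) = (0.1693 : ℝ) := by norm_num
  rw [e] at h
  exact h

end Summit.CriticalPhenomena.PercolationContinuityZ3.Theorems.Pcint
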